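import Summits.CriticalPhenomena.Ising3DConformalLimit.Theses.PrecisionLaplacian
import HarnessLib
import Summits.CriticalPhenomena.Ising3DConformalLimit.Theorems.PrecisionLaplacianDirectCorrelationStableTailPointwiseUpgradeAux

/-!
# Axis marginal of the stable Lévy density `Ψ(y) = Φ(ŷ)|y|₂^{-(3+α)}` — stub `stub_axisMarginal`

Theorem file for stub `stub_axisMarginal` of line `self-energy-pick-inversion`, crux
`PrecisionLaplacian.DirectCorrelationStableTail` (stmt-CriticalPhenomena-4799). Pure theorem file,
Ising-free; everything is folklore real analysis on `ℝ³ = Fin 3 → ℝ` (sup norm `‖·‖`, Euclidean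
norm written `√(∑ l, y l ^ 2)`, direction `ŷ_j = y_j / √(∑ l, y l ^ 2)`).

* Part C: the concrete density is continuous off the origin, `≥ 0`, homogeneous of degree
  `-(3+α)` under positive dilations, `≤ M‖y‖^{-(3+α)}`, and `> 0` somewhere off `{y_i = 0}`.
* Part A: such a function is integrable on `{‖y‖ ≥ δ}` (`δ > 0`) and has integrable slices
  `z ↦ Ψ(ins_i(c, z))`, `c ≠ 0` (domination by `(1 + ‖·‖)^{-(3+α)}`, `integrable_one_add_norm`).
* Part B: Fubini along the `i`-th axis (`MeasurableEquiv.piFinSuccAbove` is volume preserving),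
  the dilation `H(±t) = t^{-(1+α)} H(±1)` of the slice integrals `H(t) = ∫ Ψ(ins_i(t, z)) dz`
  (`Measure.integral_comp_smul` on `ℝ²`), and the 1-d reduction
  `∫ g(|t|) H(t) dt = (H 1 + H (-1)) ∫₀^∞ g(s) s^{-(1+α)} ds`; `F = H 1 + H (-1) > 0` because a
  slice through a positivity point of `Ψ` has positive integral.
-/

noncomputable section

namespace Summit.CriticalPhenomena.Ising3DConformalLimit.Cruxes.DirectCorrelationStableTail.SelfEnergyPickInversion

open MeasureTheory Filter Topology
open scoped BigOperators

/-! ### Part C: the concrete density `Ψ(y) = Φ(ŷ) |y|₂^{-(3+α)}` -/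

/-- A non-zero vector of `ℝ³` has positive Euclidean norm. [folklore] -/
theorem sqrt_sum_sq_pos_of_ne_zero {y : Fin 3 → ℝ} (hy : y ≠ 0) : 0 < √(∑ l, y l ^ 2) := by
  obtain ⟨j, hj⟩ : ∃ j, y j ≠ 0 := by
    by_contra h
    push Not at h
    exact hy (funext h)
  refine Real.sqrt_pos.2 (lt_of_lt_of_le (by positivity : (0 : ℝ) < y j ^ 2) ?_)
  exact Finset.single_le_sum (f := fun l => y l ^ 2) (fun l _ => sq_nonneg (y l))
    (Finset.mem_univ j)

/-- The direction `ŷ = y/|y|₂` of a non-zero vector lies on the Euclidean unit sphere. [folklore] -/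
theorem sum_sq_div_sqrt_eq_one {y : Fin 3 → ℝ} (hy : y ≠ 0) :
    ∑ j, (y j / √(∑ l, y l ^ 2)) ^ 2 = 1 := by
  have hpos : 0 < ∑ l, y l ^ 2 := Real.sqrt_pos.1 (sqrt_sum_sq_pos_of_ne_zero hy)
  simp_rw [div_pow]
  rw [← Finset.sum_div, Real.sq_sqrt hpos.le, div_self hpos.ne']

/-- The density `Φ(ŷ)|y|₂^p` is continuous away from the origin when the angular profile `Φ` is
continuous on the unit sphere. [folklore] -/
theorem continuousOn_profile_mul_rpow {Φ : (Fin 3 → ℝ) → ℝ} (p : ℝ)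
    (hΦ : ContinuousOn Φ {u : Fin 3 → ℝ | ∑ j, u j ^ 2 = 1}) :
    ContinuousOn (fun y : Fin 3 → ℝ => Φ (fun j => y j / √(∑ l, y l ^ 2)) * √(∑ l, y l ^ 2) ^ p)
      {y : Fin 3 → ℝ | y ≠ 0} := by
  have hr : Continuous fun y : Fin 3 → ℝ => √(∑ l, y l ^ 2) := by fun_prop
  have hr0 : ∀ y ∈ {y : Fin 3 → ℝ | y ≠ 0}, √(∑ l, y l ^ 2) ≠ 0 := fun y hy =>
    (sqrt_sum_sq_pos_of_ne_zero hy).ne'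
  refine ContinuousOn.mul ?_ (hr.continuousOn.rpow_const fun y hy => Or.inl (hr0 y hy))
  refine hΦ.comp (continuousOn_pi.2 fun j =>
    ((continuous_apply j).continuousOn).div hr.continuousOn hr0) ?_
  intro y hy
  exact sum_sq_div_sqrt_eq_one hy

/-- The density `Φ(ŷ)|y|₂^{-(3+α)}` (`α > 0`) is non-negative when `Φ ≥ 0` on the sphere (at the
origin it vanishes, `0 ^ (-(3+α)) = 0`). [folklore] -/
theorem profile_mul_rpow_nonneg {α : ℝ} {Φ : (Fin 3 → ℝ) → ℝ} (hα : 0 < α)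
    (hΦ0 : ∀ u : Fin 3 → ℝ, ∑ j, u j ^ 2 = 1 → 0 ≤ Φ u) (y : Fin 3 → ℝ) :
    0 ≤ Φ (fun j => y j / √(∑ l, y l ^ 2)) * √(∑ l, y l ^ 2) ^ (-(3 + α)) := by
  by_cases hy : y = 0
  · subst hy
    have h0 : √(∑ l : Fin 3, (0 : Fin 3 → ℝ) l ^ 2) = 0 := by simp
    rw [h0, Real.zero_rpow (by linarith : (-(3 + α) : ℝ) ≠ 0), mul_zero]
  · exact mul_nonneg (hΦ0 _ (sum_sq_div_sqrt_eq_one hy)) (Real.rpow_nonneg (Real.sqrt_nonneg _) _)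

/-- Homogeneity: `Ψ(t • y) = t^p Ψ(y)` for `t > 0`, where `Ψ(y) = Φ(ŷ)|y|₂^p`. [folklore] -/
theorem profile_mul_rpow_smul {Φ : (Fin 3 → ℝ) → ℝ} (p : ℝ) {t : ℝ} (ht : 0 < t)
    (y : Fin 3 → ℝ) :
    Φ (fun j => (t • y) j / √(∑ l, (t • y) l ^ 2)) * √(∑ l, (t • y) l ^ 2) ^ p =
      t ^ p * (Φ (fun j => y j / √(∑ l, y l ^ 2)) * √(∑ l, y l ^ 2) ^ p) := by
  have hsm : ∀ j, (t • y) j = t * y j := fun j => rfl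
  simp_rw [hsm]
  rw [sqrt_sum_sq_const_mul, abs_of_pos ht]
  have hdir : (fun j => t * y j / (t * √(∑ l, y l ^ 2))) = fun j => y j / √(∑ l, y l ^ 2) := by
    funext j
    rw [mul_div_mul_left _ _ ht.ne']
  rw [hdir, Real.mul_rpow ht.le (Real.sqrt_nonneg _)]
  ring

/-- A priori bound: `Ψ(y) ≤ M ‖y‖^{-(3+α)}` off the origin (`‖·‖` the sup norm), with
`M = max (sup_S |Φ|) 0`. [folklore] -/
theorem profile_mul_rpow_le {α : ℝ} {Φ : (Fin 3 → ℝ) → ℝ} (hα : 0 < α)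
    (hΦ : ContinuousOn Φ {u : Fin 3 → ℝ | ∑ j, u j ^ 2 = 1}) :
    ∃ M : ℝ, 0 ≤ M ∧ ∀ y : Fin 3 → ℝ, y ≠ 0 →
      Φ (fun j => y j / √(∑ l, y l ^ 2)) * √(∑ l, y l ^ 2) ^ (-(3 + α)) ≤
        M * ‖y‖ ^ (-(3 + α)) := by
  obtain ⟨C, hC⟩ := isCompact_sphere_set.exists_bound_of_continuousOn hΦ
  refine ⟨max C 0, le_max_right _ _, fun y hy => ?_⟩
  have hΦle : Φ (fun j => y j / √(∑ l, y l ^ 2)) ≤ max C 0 := by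
    have h := hC _ (sum_sq_div_sqrt_eq_one hy)
    rw [Real.norm_eq_abs] at h
    exact ((le_abs_self _).trans h).trans (le_max_left _ _)
  have hrle : √(∑ l, y l ^ 2) ^ (-(3 + α)) ≤ ‖y‖ ^ (-(3 + α)) :=
    Real.rpow_le_rpow_of_nonpos (norm_pos_iff.2 hy) (norm_le_sqrt_sum_sq y) (by linarith)
  exact mul_le_mul hΦle hrle (Real.rpow_nonneg (Real.sqrt_nonneg _) _) (le_max_right _ _)

/-- If `Φ > 0` somewhere on the sphere then `Ψ > 0` at some point off the coordinate hyperplane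
`{y_i = 0}` (the positivity set of `Ψ` is open and non-empty). [folklore] -/
theorem exists_profile_mul_rpow_pos {Φ : (Fin 3 → ℝ) → ℝ} (p : ℝ) (i : Fin 3)
    (hΦ : ContinuousOn Φ {u : Fin 3 → ℝ | ∑ j, u j ^ 2 = 1})
    (hΦp : ∃ u : Fin 3 → ℝ, ∑ j, u j ^ 2 = 1 ∧ 0 < Φ u) :
    ∃ y : Fin 3 → ℝ, y i ≠ 0 ∧
      0 < Φ (fun j => y j / √(∑ l, y l ^ 2)) * √(∑ l, y l ^ 2) ^ p := by
  obtain ⟨u, hu, hΦu⟩ := hΦp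
  have hopen : IsOpen ({y : Fin 3 → ℝ | y ≠ 0} ∩
      (fun y : Fin 3 → ℝ => Φ (fun j => y j / √(∑ l, y l ^ 2)) * √(∑ l, y l ^ 2) ^ p) ⁻¹'
        Set.Ioi 0) :=
    (continuousOn_profile_mul_rpow p hΦ).isOpen_inter_preimage isOpen_ne isOpen_Ioi
  have hu0 : u ≠ 0 := by
    rintro rfl
    simp at hu
  have hΨu : 0 < Φ (fun j => u j / √(∑ l, u l ^ 2)) * √(∑ l, u l ^ 2) ^ p := by
    rw [sqrt_sum_sq_eq_one hu]
    simpa [Real.one_rpow] using hΦu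
  obtain ⟨r, hr, hball⟩ := Metric.isOpen_iff.1 hopen u ⟨hu0, hΨu⟩
  by_cases hui : u i ≠ 0
  · exact ⟨u, hui, hΨu⟩
  · push Not at hui
    refine ⟨Function.update u i (r / 2), by simp [hr.ne'], (hball ?_).2⟩
    rw [Metric.mem_ball, dist_pi_lt_iff hr]
    intro b
    by_cases hb : b = i
    · subst hb
      rw [Function.update_self, hui, Real.dist_eq, sub_zero, abs_of_pos (half_pos hr)]
      exact half_lt_self hr
    · rw [Function.update_of_ne hb, dist_self]
      exact hr

/-! ### Part A: integrability away from the origin and of the slices -/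

/-- Comparison of negative powers: for `0 < δ ≤ x` and `0 ≤ r`,
`x^{-r} ≤ (1 + δ⁻¹)^r (1 + x)^{-r}`. [folklore] -/
theorem rpow_neg_le_one_add_rpow_neg {δ x r : ℝ} (hδ : 0 < δ) (hx : δ ≤ x) (hr : 0 ≤ r) :
    x ^ (-r) ≤ (1 + δ⁻¹) ^ r * (1 + x) ^ (-r) := by
  have hxpos : 0 < x := lt_of_lt_of_le hδ hx
  have h0 : 1 ≤ δ⁻¹ * x := by
    rw [← div_eq_inv_mul]
    exact (one_le_div hδ).2 hx
  have h1 : 1 + x ≤ (1 + δ⁻¹) * x := by nlinarith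
  have h2 : ((1 + δ⁻¹) * x) ^ (-r) ≤ (1 + x) ^ (-r) :=
    Real.rpow_le_rpow_of_nonpos (by positivity) h1 (by linarith)
  rw [Real.mul_rpow (by positivity) hxpos.le,
    Real.rpow_neg (by positivity : (0 : ℝ) ≤ 1 + δ⁻¹)] at h2
  have hc : 0 < (1 + δ⁻¹) ^ r := Real.rpow_pos_of_pos (by positivity) _
  rwa [inv_mul_le_iff₀ hc] at h2

/-- A non-negative function on `ℝ³`, continuous off the origin and `≤ M‖y‖^{-(3+α)}` there
(`α > 0`), is integrable on `{‖y‖ ≥ δ}` for every `δ > 0`. [folklore] -/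
theorem integrableOn_of_le_norm_rpow_neg {α : ℝ} {Ψ : (Fin 3 → ℝ) → ℝ} (hα : 0 < α)
    (hcont : ContinuousOn Ψ {y | y ≠ 0}) (hnn : ∀ y, 0 ≤ Ψ y) {M : ℝ} (hM0 : 0 ≤ M)
    (hM : ∀ y, y ≠ 0 → Ψ y ≤ M * ‖y‖ ^ (-(3 + α))) {δ : ℝ} (hδ : 0 < δ) :
    IntegrableOn Ψ {y : Fin 3 → ℝ | δ ≤ ‖y‖} := by
  have hmeas : MeasurableSet {y : Fin 3 → ℝ | δ ≤ ‖y‖} :=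
    (isClosed_le continuous_const continuous_norm).measurableSet
  have hsub : {y : Fin 3 → ℝ | δ ≤ ‖y‖} ⊆ {y | y ≠ 0} := by
    intro y hy h0
    simp only [Set.mem_setOf_eq, h0, norm_zero] at hy
    exact absurd hy (not_le.2 hδ)
  have hint : Integrable
      (fun y : Fin 3 → ℝ => M * (1 + δ⁻¹) ^ (3 + α) * (1 + ‖y‖) ^ (-(3 + α))) := by
    refine (integrable_one_add_norm ?_).const_mul _
    simp only [Module.finrank_fin_fun, Nat.cast_ofNat]
    linarith
  refine Integrable.mono' hint.integrableOn ((hcont.mono hsub).aestronglyMeasurable hmeas) ?_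
  rw [ae_restrict_iff' hmeas]
  refine Eventually.of_forall fun y hy => ?_
  rw [Real.norm_eq_abs, abs_of_nonneg (hnn y)]
  calc Ψ y ≤ M * ‖y‖ ^ (-(3 + α)) := hM y (hsub hy)
    _ ≤ M * ((1 + δ⁻¹) ^ (3 + α) * (1 + ‖y‖) ^ (-(3 + α))) :=
        mul_le_mul_of_nonneg_left (rpow_neg_le_one_add_rpow_neg hδ hy (by linarith)) hM0
    _ = M * (1 + δ⁻¹) ^ (3 + α) * (1 + ‖y‖) ^ (-(3 + α)) := by ring

/-- Under the same hypotheses the slices `z ↦ Ψ(ins_i(c, z))`, `c ≠ 0`, are integrable on `ℝ²`.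
[folklore] -/
theorem integrable_slice_of_le_norm_rpow_neg {α : ℝ} {Ψ : (Fin 3 → ℝ) → ℝ} (hα : 0 < α)
    (i : Fin 3) (hcont : ContinuousOn Ψ {y | y ≠ 0}) (hnn : ∀ y, 0 ≤ Ψ y) {M : ℝ} (hM0 : 0 ≤ M)
    (hM : ∀ y, y ≠ 0 → Ψ y ≤ M * ‖y‖ ^ (-(3 + α))) {c : ℝ} (hc : c ≠ 0) :
    Integrable (fun z : Fin 2 → ℝ => Ψ (Fin.insertNth i c z)) := by
  have hne : ∀ z : Fin 2 → ℝ, (Fin.insertNth i c z : Fin 3 → ℝ) ≠ 0 := fun z h => by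
    have := congr_fun h i
    rw [Fin.insertNth_apply_same] at this
    exact hc this
  have hins : Continuous fun z : Fin 2 → ℝ => (Fin.insertNth i c z : Fin 3 → ℝ) := by fun_prop
  have hcz : Continuous fun z : Fin 2 → ℝ => Ψ (Fin.insertNth i c z) :=
    hcont.comp_continuous hins hne
  have hnorm1 : ∀ z : Fin 2 → ℝ, |c| ≤ ‖(Fin.insertNth i c z : Fin 3 → ℝ)‖ := fun z => by
    have := norm_le_pi_norm (Fin.insertNth i c z : Fin 3 → ℝ) i
    rwa [Fin.insertNth_apply_same, Real.norm_eq_abs] at this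
  have hnorm2 : ∀ z : Fin 2 → ℝ, ‖z‖ ≤ ‖(Fin.insertNth i c z : Fin 3 → ℝ)‖ := fun z =>
    (pi_norm_le_iff_of_nonneg (norm_nonneg _)).2 fun j => by
      have := norm_le_pi_norm (Fin.insertNth i c z : Fin 3 → ℝ) (i.succAbove j)
      rwa [Fin.insertNth_apply_succAbove] at this
  have hint : Integrable
      (fun z : Fin 2 → ℝ => M * (1 + |c|⁻¹) ^ (3 + α) * (1 + ‖z‖) ^ (-(3 + α))) := by
    refine (integrable_one_add_norm ?_).const_mul _
    simp only [Module.finrank_fin_fun, Nat.cast_ofNat]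
    linarith
  refine Integrable.mono' hint hcz.aestronglyMeasurable (Eventually.of_forall fun z => ?_)
  rw [Real.norm_eq_abs, abs_of_nonneg (hnn _)]
  have hcpos : 0 < |c| := abs_pos.2 hc
  calc Ψ (Fin.insertNth i c z) ≤ M * ‖(Fin.insertNth i c z : Fin 3 → ℝ)‖ ^ (-(3 + α)) :=
        hM _ (hne z)
    _ ≤ M * ((1 + |c|⁻¹) ^ (3 + α) * (1 + ‖(Fin.insertNth i c z : Fin 3 → ℝ)‖) ^ (-(3 + α))) :=
        mul_le_mul_of_nonneg_left (rpow_neg_le_one_add_rpow_neg hcpos (hnorm1 z) (by linarith))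
          hM0
    _ ≤ M * ((1 + |c|⁻¹) ^ (3 + α) * (1 + ‖z‖) ^ (-(3 + α))) :=
        mul_le_mul_of_nonneg_left (mul_le_mul_of_nonneg_left
          (Real.rpow_le_rpow_of_nonpos (by positivity) (by linarith [hnorm2 z]) (by linarith))
          (Real.rpow_nonneg (by positivity) _)) hM0
    _ = M * (1 + |c|⁻¹) ^ (3 + α) * (1 + ‖z‖) ^ (-(3 + α)) := by ring

/-! ### Part B: Fubini along the axis, dilation of the slices, the 1-d reduction -/

/-- `ins_i(tc, t • z) = t • ins_i(c, z)`. [folklore] -/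
theorem insertNth_mul_smul_eq (i : Fin 3) (t c : ℝ) (z : Fin 2 → ℝ) :
    (Fin.insertNth i (t * c) (t • z) : Fin 3 → ℝ) = t • (Fin.insertNth i c z : Fin 3 → ℝ) := by
  funext j
  rcases Fin.eq_self_or_eq_succAbove i j with rfl | ⟨k, rfl⟩
  · simp [Fin.insertNth_apply_same]
  · simp [Fin.insertNth_apply_succAbove]

/-- Dilation of the slice integrals: for `Ψ` homogeneous of degree `-(3+α)` under positive
dilations, `∫ Ψ(ins_i(tc, z)) dz = t^{-(1+α)} ∫ Ψ(ins_i(c, z)) dz` (`t > 0`). [folklore] -/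
theorem integral_slice_dilate {α : ℝ} {Ψ : (Fin 3 → ℝ) → ℝ} (i : Fin 3)
    (hhom : ∀ (t : ℝ) (y : Fin 3 → ℝ), 0 < t → Ψ (t • y) = t ^ (-(3 + α)) * Ψ y)
    {t : ℝ} (ht : 0 < t) (c : ℝ) :
    ∫ z : Fin 2 → ℝ, Ψ (Fin.insertNth i (t * c) z) =
      t ^ (-(1 + α)) * ∫ z : Fin 2 → ℝ, Ψ (Fin.insertNth i c z) := by
  have h1 : ∫ z : Fin 2 → ℝ, Ψ (Fin.insertNth i (t * c) (t • z)) =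
      (t ^ 2)⁻¹ * ∫ z : Fin 2 → ℝ, Ψ (Fin.insertNth i (t * c) z) := by
    have := Measure.integral_comp_smul volume
      (fun z : Fin 2 → ℝ => Ψ (Fin.insertNth i (t * c) z)) t
    simp only [Module.finrank_fin_fun, smul_eq_mul] at this
    rw [this, abs_of_nonneg (inv_nonneg.2 (pow_nonneg ht.le 2))]
  have h2 : ∫ z : Fin 2 → ℝ, Ψ (Fin.insertNth i (t * c) (t • z)) =
      t ^ (-(3 + α)) * ∫ z : Fin 2 → ℝ, Ψ (Fin.insertNth i c z) := by
    simp_rw [insertNth_mul_smul_eq, hhom t _ ht]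
    exact integral_const_mul _ _
  have ht2 : (t ^ 2 : ℝ) ≠ 0 := by positivity
  rw [h1, inv_mul_eq_iff_eq_mul₀ ht2] at h2
  rw [h2, ← mul_assoc]
  congr 1
  rw [← Real.rpow_natCast t 2, ← Real.rpow_add ht]
  congr 1
  push_cast
  ring

/-- Fubini along the `i`-th axis: `∫_{ℝ³} f = ∫_ℝ (∫_{ℝ²} f(ins_i(t, z)) dz) dt` for integrable `f`,
and the inner integral is an integrable function of `t`. [folklore] -/
theorem integral_eq_integral_integral_insertNth (i : Fin 3) {f : (Fin 3 → ℝ) → ℝ}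
    (hf : Integrable f) :
    Integrable (fun t : ℝ => ∫ z : Fin 2 → ℝ, f (Fin.insertNth i t z)) ∧
    ∫ y, f y = ∫ t : ℝ, ∫ z : Fin 2 → ℝ, f (Fin.insertNth i t z) := by
  set e := MeasurableEquiv.piFinSuccAbove (fun _ : Fin 3 => ℝ) i with he
  have hmp : MeasurePreserving e volume volume := volume_preserving_piFinSuccAbove (fun _ => ℝ) i
  have he_symm : ∀ p : ℝ × (Fin 2 → ℝ), e.symm p = Fin.insertNth i p.1 p.2 := fun p => rfl
  have h2 : Integrable (fun p : ℝ × (Fin 2 → ℝ) => f (e.symm p))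
      ((volume : Measure ℝ).prod (volume : Measure (Fin 2 → ℝ))) :=
    (hmp.symm.integrable_comp_emb e.symm.measurableEmbedding).2 hf
  have h1 : ∫ y, f y = ∫ p : ℝ × (Fin 2 → ℝ), f (e.symm p) :=
    (hmp.symm.integral_comp' f).symm
  refine ⟨?_, ?_⟩
  · have h3 := h2.integral_prod_left
    simpa only [he_symm] using h3
  · rw [h1, Measure.volume_eq_prod, integral_prod _ h2]
    rfl

/-- Integrability of `y ↦ g(|y_i|) Ψ(y)` for `g` continuous, compactly supported in `(0, ∞)`, and
`Ψ` integrable on every `{‖y‖ ≥ δ}`, `δ > 0`. [folklore] -/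
theorem integrable_test_abs_mul (i : Fin 3) {Ψ : (Fin 3 → ℝ) → ℝ}
    (hint : ∀ δ : ℝ, 0 < δ → IntegrableOn Ψ {y : Fin 3 → ℝ | δ ≤ ‖y‖})
    {g : ℝ → ℝ} (hg : Continuous g) (hgc : HasCompactSupport g) (hg0 : tsupport g ⊆ Set.Ioi 0) :
    Integrable (fun y : Fin 3 → ℝ => g (|y i|) * Ψ y) := by
  obtain ⟨ε, hε, hgε⟩ : ∃ ε : ℝ, 0 < ε ∧ ∀ s, s < ε → g s = 0 := by
    have h0 : (0 : ℝ) ∈ (tsupport g)ᶜ := fun h => lt_irrefl (0 : ℝ) (hg0 h)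
    obtain ⟨ε, hε, hball⟩ := Metric.isOpen_iff.1 (isClosed_tsupport g).isOpen_compl 0 h0
    refine ⟨ε, hε, fun s hs => ?_⟩
    by_cases hs0 : 0 < s
    · refine image_eq_zero_of_notMem_tsupport (hball ?_)
      rw [Metric.mem_ball, Real.dist_eq, sub_zero, abs_of_pos hs0]
      exact hs
    · exact image_eq_zero_of_notMem_tsupport fun h => hs0 (hg0 h)
  obtain ⟨C, hC⟩ := hg.bounded_above_of_compact_support hgc
  have hon : IntegrableOn (fun y : Fin 3 → ℝ => g (|y i|) * Ψ y) {y | ε ≤ ‖y‖} := by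
    refine Integrable.bdd_mul (hint ε hε) ?_ (Eventually.of_forall fun y => hC _)
    exact (hg.comp (continuous_abs.comp (continuous_apply i))).aestronglyMeasurable
  refine hon.integrable_of_forall_notMem_eq_zero fun y hy => ?_
  have hlt : |y i| < ε := by
    simp only [Set.mem_setOf_eq, not_le] at hy
    exact lt_of_le_of_lt (by simpa [Real.norm_eq_abs] using norm_le_pi_norm y i) hy
  rw [hgε _ hlt, zero_mul]

/-- The 1-d reduction: if `H(t) = t^{-(1+α)} H(1)` and `H(-t) = t^{-(1+α)} H(-1)` for `t > 0` then
`∫ g(|t|) H(t) dt = (H 1 + H (-1)) ∫₀^∞ g(s) s^{-(1+α)} ds`. [folklore] -/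
theorem integral_abs_test_mul_of_dilate {α : ℝ} {H g : ℝ → ℝ}
    (hHpos : ∀ t : ℝ, 0 < t → H t = t ^ (-(1 + α)) * H 1)
    (hHneg : ∀ t : ℝ, 0 < t → H (-t) = t ^ (-(1 + α)) * H (-1))
    (hG : Integrable (fun t => g (|t|) * H t)) :
    ∫ t, g (|t|) * H t = (H 1 + H (-1)) * ∫ s in Set.Ioi (0 : ℝ), g s * s ^ (-(1 + α)) := by
  rw [← integral_add_compl (measurableSet_Ioi (a := (0 : ℝ))) hG, Set.compl_Ioi, add_mul]
  congr 1
  · rw [← integral_const_mul]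
    refine setIntegral_congr_fun measurableSet_Ioi fun t ht => ?_
    rw [abs_of_pos (show 0 < t from ht), hHpos t ht]
    ring
  · rw [show Set.Iic (0 : ℝ) = Set.Iic (-0) by rw [neg_zero], ← integral_comp_neg_Ioi,
      ← integral_const_mul]
    refine setIntegral_congr_fun measurableSet_Ioi fun t ht => ?_
    rw [abs_neg, abs_of_pos (show 0 < t from ht), hHneg t ht]
    ring

/-- **Abstract axis-marginal identity.** For `Ψ ≥ 0` on `ℝ³`, continuous off the origin,
homogeneous of degree `-(3+α)` (`α > 0`), integrable on every `{‖y‖ ≥ δ}`, with integrable slices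
and positive somewhere off `{y_i = 0}`, there is `F > 0` with
`∫ g(|y_i|) Ψ(y) dy = F ∫₀^∞ g(s) s^{-(1+α)} ds` for all `g ∈ C_c((0,∞))`. [folklore] -/
theorem axisMarginal_of_homogeneous {α : ℝ} {Ψ : (Fin 3 → ℝ) → ℝ} (i : Fin 3)
    (hcont : ContinuousOn Ψ {y | y ≠ 0}) (hnn : ∀ y, 0 ≤ Ψ y)
    (hhom : ∀ (t : ℝ) (y : Fin 3 → ℝ), 0 < t → Ψ (t • y) = t ^ (-(3 + α)) * Ψ y)
    (hint : ∀ δ : ℝ, 0 < δ → IntegrableOn Ψ {y : Fin 3 → ℝ | δ ≤ ‖y‖})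
    (hslice : ∀ c : ℝ, c ≠ 0 → Integrable (fun z : Fin 2 → ℝ => Ψ (Fin.insertNth i c z)))
    (hpos : ∃ y : Fin 3 → ℝ, y i ≠ 0 ∧ 0 < Ψ y) :
    ∃ F : ℝ, 0 < F ∧ ∀ g : ℝ → ℝ, Continuous g → HasCompactSupport g → tsupport g ⊆ Set.Ioi 0 →
      ∫ y : Fin 3 → ℝ, g (|y i|) * Ψ y = F * ∫ s in Set.Ioi (0 : ℝ), g s * s ^ (-(1 + α)) := by
  have hH0 : ∀ t : ℝ, 0 ≤ ∫ z : Fin 2 → ℝ, Ψ (Fin.insertNth i t z) := fun t =>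
    integral_nonneg fun z => hnn _
  have hHpos : ∀ t : ℝ, 0 < t → ∫ z : Fin 2 → ℝ, Ψ (Fin.insertNth i t z) =
      t ^ (-(1 + α)) * ∫ z : Fin 2 → ℝ, Ψ (Fin.insertNth i 1 z) := fun t ht => by
    have := integral_slice_dilate i hhom ht 1
    rwa [mul_one] at this
  have hHneg : ∀ t : ℝ, 0 < t → ∫ z : Fin 2 → ℝ, Ψ (Fin.insertNth i (-t) z) =
      t ^ (-(1 + α)) * ∫ z : Fin 2 → ℝ, Ψ (Fin.insertNth i (-1) z) := fun t ht => by
    have := integral_slice_dilate i hhom ht (-1)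
    rwa [mul_neg, mul_one] at this
  have hFpos : 0 < (∫ z : Fin 2 → ℝ, Ψ (Fin.insertNth i 1 z)) +
      ∫ z : Fin 2 → ℝ, Ψ (Fin.insertNth i (-1) z) := by
    obtain ⟨y, hyi, hy⟩ := hpos
    have hne : ∀ z : Fin 2 → ℝ, (Fin.insertNth i (y i) z : Fin 3 → ℝ) ≠ 0 := fun z h => by
      have := congr_fun h i
      rw [Fin.insertNth_apply_same] at this
      exact hyi this
    have hins : Continuous fun z : Fin 2 → ℝ => (Fin.insertNth i (y i) z : Fin 3 → ℝ) := by
      fun_prop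
    have hcts : Continuous fun z : Fin 2 → ℝ => Ψ (Fin.insertNth i (y i) z) :=
      hcont.comp_continuous hins hne
    have hHc : 0 < ∫ z : Fin 2 → ℝ, Ψ (Fin.insertNth i (y i) z) := by
      rw [integral_pos_iff_support_of_nonneg (fun z => hnn _) (hslice _ hyi)]
      refine lt_of_lt_of_le ((isOpen_Ioi.preimage hcts).measure_pos volume ⟨i.removeNth y, ?_⟩)
        (measure_mono fun z hz => ne_of_gt hz)
      show 0 < Ψ (Fin.insertNth i (y i) (i.removeNth y))
      rwa [Fin.insertNth_self_removeNth]
    rcases lt_or_gt_of_ne hyi with hneg | hposi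
    · have h := hHneg (-y i) (neg_pos.2 hneg)
      rw [neg_neg] at h
      rw [h] at hHc
      have := pos_of_mul_pos_right hHc (Real.rpow_nonneg (neg_pos.2 hneg).le _)
      linarith [hH0 1]
    · rw [hHpos (y i) hposi] at hHc
      have := pos_of_mul_pos_right hHc (Real.rpow_nonneg hposi.le _)
      linarith [hH0 (-1)]
  refine ⟨_, hFpos, fun g hg hgc hg0 => ?_⟩
  obtain ⟨hG, hfub⟩ :=
    integral_eq_integral_integral_insertNth i (integrable_test_abs_mul i hint hg hgc hg0)
  simp only [Fin.insertNth_apply_same, integral_const_mul] at hG hfub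
  rw [hfub]
  exact integral_abs_test_mul_of_dilate hHpos hHneg hG

/-! ### Assembly -/

/-- **STUB 10 `stub_axisMarginal`** of line `self-energy-pick-inversion` (crux
`PrecisionLaplacian.DirectCorrelationStableTail`, stmt-CriticalPhenomena-4799): the density
`Ψ(y) = Φ(ŷ)|y|₂^{-(3+α)}` (`α > 0`, `Φ` continuous and `≥ 0` on the sphere, `> 0` somewhere) is
integrable on every `{‖y‖ ≥ δ}`, `δ > 0`, and its `i`-th axis marginal tested against
`g ∈ C_c((0,∞))` is `F ∫₀^∞ g(s) s^{-(1+α)} ds` for some `F > 0`. [folklore] -/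
theorem stub_axisMarginal : ∀ (α : ℝ) (Φ : (Fin 3 → ℝ) → ℝ) (i : Fin 3), 0 < α → ContinuousOn Φ {u : Fin 3 → ℝ | ∑ j, u j ^ 2 = 1} → (∀ u : Fin 3 → ℝ, ∑ j, u j ^ 2 = 1 → 0 ≤ Φ u) → (∃ u : Fin 3 → ℝ, ∑ j, u j ^ 2 = 1 ∧ 0 < Φ u) → (∀ δ : ℝ, 0 < δ → MeasureTheory.IntegrableOn (fun y : Fin 3 → ℝ => Φ (fun j => y j / Real.sqrt (∑ l, y l ^ 2)) * Real.sqrt (∑ l, y l ^ 2) ^ (-(3 + α))) {y : Fin 3 → ℝ | δ ≤ ‖y‖}) ∧ ∃ F : ℝ, 0 < F ∧ ∀ g : ℝ → ℝ, Continuous g → HasCompactSupport g → tsupport g ⊆ Set.Ioi 0 → ∫ y : Fin 3 → ℝ, g (|y i|) * (Φ (fun j => y j / Real.sqrt (∑ l, y l ^ 2)) * Real.sqrt (∑ l, y l ^ 2) ^ (-(3 + α))) = F * ∫ s in Set.Ioi (0 : ℝ), g s * s ^ (-(1 + α)) := by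
  intro α Φ i hα hΦ hΦ0 hΦp
  obtain ⟨M, hM0, hM⟩ := profile_mul_rpow_le hα hΦ
  have hcont := continuousOn_profile_mul_rpow (-(3 + α)) hΦ
  have hnn := profile_mul_rpow_nonneg hα hΦ0
  have hint : ∀ δ : ℝ, 0 < δ → IntegrableOn (fun y : Fin 3 → ℝ =>
      Φ (fun j => y j / √(∑ l, y l ^ 2)) * √(∑ l, y l ^ 2) ^ (-(3 + α))) {y : Fin 3 → ℝ | δ ≤ ‖y‖} :=
    fun δ hδ => integrableOn_of_le_norm_rpow_neg hα hcont hnn hM0 hM hδ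
  exact ⟨hint, axisMarginal_of_homogeneous i hcont hnn (fun t y ht => profile_mul_rpow_smul _ ht y)
    hint (fun c hc => integrable_slice_of_le_norm_rpow_neg hα i hcont hnn hM0 hM hc)
    (exists_profile_mul_rpow_pos _ i hΦ hΦp)⟩

end Summit.CriticalPhenomena.Ising3DConformalLimit.Cruxes.DirectCorrelationStableTail.SelfEnergyPickInversion

end
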